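import Summits.HubbardSuperconductivity.HubbardSuperconductivity.Theorems.AnisotropyChordTransferFibre3LemmaVTargets
import Summits.HubbardSuperconductivity.HubbardSuperconductivity.Theorems.AnisotropyChordTransferFibre3TwoMagnonQF

/-!
# Route `AnisotropyChord` / H0 rotor rung: SYMMETRY REDUCTIONS of HOLE₂ (`TwoHoleGap L g`) — real test functions, translation, point group, representatives

`TwoHoleGap L g` (…Fibre3LemmaVTargets) quantifies over all ordered pairs of distinct holes `z₁ ≠ z₂` of the `L × L` torus and
over complex test functions.  Any per-`L` certificate (the Birman–Schwinger form of p2's `twoHoleGap_of_bsCert`, or a direct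
rational `LDLᵀ` of `Q − ĝI′ + (ĝ/n)J′`) is a statement about ONE pair and REAL quadratic forms.  This file provides the reductions:
* `TwoHoleGapRealAt g z₁ z₂`: the real single-pair form of the inequality;
* `twoHoleGap_of_real`: real test functions at every pair suffice (`‖f‖² = (Re f)² + (Im f)²` termwise);
* `twoHoleGapRealAt_of_translate`: the pair `(0, z₂ − z₁)` gives the pair `(z₁, z₂)` (translation `x ↦ x + z₁`);
* `twoHoleGapRealAt_zero_of_addEquiv`: transport along any additive automorphism of the torus permuting the four lattice
  directions; instances `…_of_neg` (`z ↦ −z`), `…_of_swap` (`(a,b) ↦ (b,a)`), `…_of_mirror` (`(a,b) ↦ (−a,b)`);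
* `d4Orbit z` (the eight images) and ★ `twoHoleGap_of_reps`: if a finite set `S` of separations meets the `D₄`-orbit of every
  `z ≠ 0` (a `decide`-able finite check at fixed `L`) and the real single-pair inequality holds for `(0, s)`, `s ∈ S`, then
  `TwoHoleGap L g`; `twoHoleGap_mono`: monotonicity in `g`.
Prover seat `hubbard-h0-rotor-p1` g24; helper for stmt-HubbardSuperconductivity-19089 (`--supports`).
-/

set_option linter.dupNamespace false
set_option autoImplicit false

noncomputable section

open scoped BigOperators
open Complex

namespace Summit.HubbardSuperconductivity.HubbardSuperconductivity.Theorems.AnisotropyChord.Transfer.Fibre3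

variable (L : ℕ) [NeZero L]

/-- the REAL single-pair form of the two-hole Poincaré inequality (holes `z₁, z₂`; same guards as `TwoHoleGap`). [folklore] -/
def TwoHoleGapRealAt (g : ℝ) (z₁ z₂ : Tor L) : Prop :=
  ∀ u : Tor L → ℝ, (∑ x : Tor L, (if (x = z₁ ∨ x = z₂) then (0 : ℝ) else u x)) = 0 →
    g * (∑ x : Tor L, (if (x = z₁ ∨ x = z₂) then (0 : ℝ) else u x ^ 2)) ≤
      (1 / 4 : ℝ) * ∑ x : Tor L, ((nnList L).map (fun e =>
        if (x = z₁ ∨ x = z₂ ∨ x + e = z₁ ∨ x + e = z₂) then (0 : ℝ) else (u x - u (x + e)) ^ 2)).sum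

/-! ## Real test functions suffice -/

/-- ★ real test functions at every pair of distinct holes give `TwoHoleGap`. [folklore] -/
theorem twoHoleGap_of_real {g : ℝ} (h : ∀ z₁ z₂ : Tor L, z₁ ≠ z₂ → TwoHoleGapRealAt L g z₁ z₂) : TwoHoleGap L g := by
  intro z₁ z₂ hne f hmean
  set u : Tor L → ℝ := fun x => (f x).re with hu
  set v : Tor L → ℝ := fun x => (f x).im with hv
  -- the two real means vanish
  have hmu : (∑ x : Tor L, (if (x = z₁ ∨ x = z₂) then (0 : ℝ) else u x)) = 0 := by
    have := congrArg Complex.re hmean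
    rw [Complex.re_sum] at this
    simpa [hu, apply_ite Complex.re] using this
  have hmv : (∑ x : Tor L, (if (x = z₁ ∨ x = z₂) then (0 : ℝ) else v x)) = 0 := by
    have := congrArg Complex.im hmean
    rw [Complex.im_sum] at this
    simpa [hv, apply_ite Complex.im] using this
  have hU := h z₁ z₂ hne u hmu
  have hV := h z₁ z₂ hne v hmv
  -- split the complex squares
  have hsq : ∀ x : Tor L, (if (x = z₁ ∨ x = z₂) then (0 : ℝ) else ‖f x‖ ^ 2)
      = (if (x = z₁ ∨ x = z₂) then (0 : ℝ) else u x ^ 2) + (if (x = z₁ ∨ x = z₂) then (0 : ℝ) else v x ^ 2) := by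
    intro x
    split_ifs
    · simp
    · rw [← Complex.normSq_eq_norm_sq, Complex.normSq_apply]; simp only [hu, hv]; ring
  have hbd : ∀ x e : Tor L,
      (if (x = z₁ ∨ x = z₂ ∨ x + e = z₁ ∨ x + e = z₂) then (0 : ℝ) else ‖f x - f (x + e)‖ ^ 2)
        = (if (x = z₁ ∨ x = z₂ ∨ x + e = z₁ ∨ x + e = z₂) then (0 : ℝ) else (u x - u (x + e)) ^ 2)
          + (if (x = z₁ ∨ x = z₂ ∨ x + e = z₁ ∨ x + e = z₂) then (0 : ℝ) else (v x - v (x + e)) ^ 2) := by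
    intro x e
    split_ifs
    · simp
    · rw [← Complex.normSq_eq_norm_sq, Complex.normSq_apply]
      simp only [hu, hv, Complex.sub_re, Complex.sub_im]; ring
  rw [Finset.sum_congr rfl (fun x _ => hsq x), Finset.sum_add_distrib]
  have hR : ∀ x : Tor L, ((nnList L).map (fun e =>
        if (x = z₁ ∨ x = z₂ ∨ x + e = z₁ ∨ x + e = z₂) then (0 : ℝ) else ‖f x - f (x + e)‖ ^ 2)).sum
      = ((nnList L).map (fun e =>
          if (x = z₁ ∨ x = z₂ ∨ x + e = z₁ ∨ x + e = z₂) then (0 : ℝ) else (u x - u (x + e)) ^ 2)).sum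
        + ((nnList L).map (fun e =>
          if (x = z₁ ∨ x = z₂ ∨ x + e = z₁ ∨ x + e = z₂) then (0 : ℝ) else (v x - v (x + e)) ^ 2)).sum := by
    intro x
    rw [nnList_map_sum, nnList_map_sum, nnList_map_sum, hbd, hbd, hbd, hbd]
    ring
  rw [Finset.sum_congr rfl (fun x _ => hR x), Finset.sum_add_distrib]
  linarith

/-! ## Translation -/

/-- ★ translation: the pair `(0, z₂ − z₁)` gives the pair `(z₁, z₂)`. [folklore] -/
theorem twoHoleGapRealAt_of_translate {g : ℝ} {z₁ z₂ : Tor L} (h : TwoHoleGapRealAt L g 0 (z₂ - z₁)) :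
    TwoHoleGapRealAt L g z₁ z₂ := by
  intro u hmean
  -- shifted test function
  set w : Tor L → ℝ := fun y => u (y + z₁) with hw
  have hc : ∀ y : Tor L, (y + z₁ = z₁ ∨ y + z₁ = z₂) ↔ (y = 0 ∨ y = z₂ - z₁) := by
    intro y
    constructor
    · rintro (h1 | h2)
      · left; simpa using h1
      · right; rw [← h2]; abel
    · rintro (h1 | h2)
      · left; rw [h1, zero_add]
      · right; rw [h2]; abel
  have hce : ∀ y e : Tor L, (y + z₁ = z₁ ∨ y + z₁ = z₂ ∨ y + z₁ + e = z₁ ∨ y + z₁ + e = z₂)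
      ↔ (y = 0 ∨ y = z₂ - z₁ ∨ y + e = 0 ∨ y + e = z₂ - z₁) := by
    intro y e
    have h1 := hc y
    have h2 := hc (y + e)
    rw [show y + e + z₁ = y + z₁ + e by abel] at h2
    tauto
  -- reindex every sum by `x = y + z₁`
  have e1 : (∑ x : Tor L, (if (x = z₁ ∨ x = z₂) then (0 : ℝ) else u x))
      = ∑ y : Tor L, (if (y = 0 ∨ y = z₂ - z₁) then (0 : ℝ) else w y) := by
    refine (Fintype.sum_equiv (Equiv.addRight z₁) _ _ fun y => ?_).symm
    simp only [Equiv.coe_addRight, hw]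
    rw [if_congr (hc y) rfl rfl]
  have e2 : (∑ x : Tor L, (if (x = z₁ ∨ x = z₂) then (0 : ℝ) else u x ^ 2))
      = ∑ y : Tor L, (if (y = 0 ∨ y = z₂ - z₁) then (0 : ℝ) else w y ^ 2) := by
    refine (Fintype.sum_equiv (Equiv.addRight z₁) _ _ fun y => ?_).symm
    simp only [Equiv.coe_addRight, hw]
    rw [if_congr (hc y) rfl rfl]
  have e3 : (∑ x : Tor L, ((nnList L).map (fun e =>
        if (x = z₁ ∨ x = z₂ ∨ x + e = z₁ ∨ x + e = z₂) then (0 : ℝ) else (u x - u (x + e)) ^ 2)).sum)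
      = ∑ y : Tor L, ((nnList L).map (fun e =>
        if (y = 0 ∨ y = z₂ - z₁ ∨ y + e = 0 ∨ y + e = z₂ - z₁) then (0 : ℝ) else (w y - w (y + e)) ^ 2)).sum := by
    refine (Fintype.sum_equiv (Equiv.addRight z₁) _ _ fun y => ?_).symm
    simp only [Equiv.coe_addRight, hw]
    rw [nnList_map_sum, nnList_map_sum]
    have key : ∀ e : Tor L,
        (if (y + z₁ = z₁ ∨ y + z₁ = z₂ ∨ y + z₁ + e = z₁ ∨ y + z₁ + e = z₂) then (0 : ℝ)
          else (u (y + z₁) - u (y + z₁ + e)) ^ 2)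
        = (if (y = 0 ∨ y = z₂ - z₁ ∨ y + e = 0 ∨ y + e = z₂ - z₁) then (0 : ℝ) else (u (y + z₁) - u (y + e + z₁)) ^ 2) := by
      intro e
      rw [if_congr (hce y e) rfl (by rw [show y + z₁ + e = y + e + z₁ by abel])]
    rw [key, key, key, key]
  rw [e1] at hmean
  rw [e2, e3]
  exact h w hmean

/-! ## Point group -/

/-- transport along an additive automorphism `σ` of the torus whose inverse permutes the four lattice directions:
the pair `(0, σ z)` gives the pair `(0, z)`. [folklore] -/
theorem twoHoleGapRealAt_zero_of_addEquiv {g : ℝ} (σ : Tor L ≃+ Tor L)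
    (hperm : ∀ h : Tor L → ℝ, h (σ.symm (ex L)) + h (σ.symm (-ex L)) + h (σ.symm (ey L)) + h (σ.symm (-ey L))
      = h (ex L) + h (-ex L) + h (ey L) + h (-ey L))
    {z : Tor L} (h : TwoHoleGapRealAt L g 0 (σ z)) : TwoHoleGapRealAt L g 0 z := by
  intro u hmean
  set w : Tor L → ℝ := fun y => u (σ.symm y) with hw
  have hc : ∀ x : Tor L, (σ x = 0 ∨ σ x = σ z) ↔ (x = 0 ∨ x = z) := by
    intro x
    rw [σ.injective.eq_iff, show (σ x = 0 ↔ x = 0) from σ.map_eq_zero_iff]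
  -- reindex by `y = σ x`
  have e1 : (∑ y : Tor L, (if (y = 0 ∨ y = σ z) then (0 : ℝ) else w y))
      = ∑ x : Tor L, (if (x = 0 ∨ x = z) then (0 : ℝ) else u x) := by
    refine (Fintype.sum_equiv σ.toEquiv _ _ fun x => ?_).symm
    simp only [AddEquiv.toEquiv_eq_coe, EquivLike.coe_coe, hw, AddEquiv.symm_apply_apply]
    rw [if_congr (hc x) rfl rfl]
  have e2 : (∑ y : Tor L, (if (y = 0 ∨ y = σ z) then (0 : ℝ) else w y ^ 2))
      = ∑ x : Tor L, (if (x = 0 ∨ x = z) then (0 : ℝ) else u x ^ 2) := by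
    refine (Fintype.sum_equiv σ.toEquiv _ _ fun x => ?_).symm
    simp only [AddEquiv.toEquiv_eq_coe, EquivLike.coe_coe, hw, AddEquiv.symm_apply_apply]
    rw [if_congr (hc x) rfl rfl]
  have e3 : (∑ y : Tor L, ((nnList L).map (fun e =>
        if (y = 0 ∨ y = σ z ∨ y + e = 0 ∨ y + e = σ z) then (0 : ℝ) else (w y - w (y + e)) ^ 2)).sum)
      = ∑ x : Tor L, ((nnList L).map (fun e =>
        if (x = 0 ∨ x = z ∨ x + e = 0 ∨ x + e = z) then (0 : ℝ) else (u x - u (x + e)) ^ 2)).sum := by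
    refine (Fintype.sum_equiv σ.toEquiv _ _ fun x => ?_).symm
    simp only [AddEquiv.toEquiv_eq_coe, EquivLike.coe_coe]
    rw [nnList_map_sum, nnList_map_sum]
    -- each direction `e` at `σ x` is the direction `σ⁻¹ e` at `x`
    have key : ∀ e : Tor L,
        (if (σ x = 0 ∨ σ x = σ z ∨ σ x + e = 0 ∨ σ x + e = σ z) then (0 : ℝ) else (w (σ x) - w (σ x + e)) ^ 2)
        = (if (x = 0 ∨ x = z ∨ x + σ.symm e = 0 ∨ x + σ.symm e = z) then (0 : ℝ)
            else (u x - u (x + σ.symm e)) ^ 2) := by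
      intro e
      have hxe : σ x + e = σ (x + σ.symm e) := by rw [map_add, AddEquiv.apply_symm_apply]
      rw [hxe]
      have hc1 := hc x
      have hc2 := hc (x + σ.symm e)
      simp only [hw, AddEquiv.symm_apply_apply]
      have hiff : (σ x = 0 ∨ σ x = σ z ∨ σ (x + σ.symm e) = 0 ∨ σ (x + σ.symm e) = σ z)
          ↔ (x = 0 ∨ x = z ∨ x + σ.symm e = 0 ∨ x + σ.symm e = z) := by tauto
      rw [if_congr hiff rfl rfl]
    rw [key, key, key, key]
    exact (hperm (fun d => if (x = 0 ∨ x = z ∨ x + d = 0 ∨ x + d = z) then (0 : ℝ) else (u x - u (x + d)) ^ 2)).symm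
  have hmean' : (∑ y : Tor L, (if (y = 0 ∨ y = σ z) then (0 : ℝ) else w y)) = 0 := by rw [e1]; exact hmean
  have := h w hmean'
  rw [e2, e3] at this
  exact this

/-- `z ↦ −z`: the pair `(0, −z)` gives `(0, z)`. [folklore] -/
theorem twoHoleGapRealAt_zero_of_neg {g : ℝ} {z : Tor L} (h : TwoHoleGapRealAt L g 0 (-z)) :
    TwoHoleGapRealAt L g 0 z := by
  refine twoHoleGapRealAt_zero_of_addEquiv L (AddEquiv.neg (Tor L)) (fun k => ?_) (by simpa using h)
  simp only [AddEquiv.neg_symm, AddEquiv.neg_apply, neg_neg]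
  ring

/-- the coordinate swap as an additive automorphism of the torus. [folklore] -/
def swapEquiv : Tor L ≃+ Tor L := AddEquiv.prodComm

/-- `(a,b) ↦ (b,a)`: the pair `(0, (z₂, z₁))` gives `(0, z)`. [folklore] -/
theorem twoHoleGapRealAt_zero_of_swap {g : ℝ} {z : Tor L} (h : TwoHoleGapRealAt L g 0 (z.2, z.1)) :
    TwoHoleGapRealAt L g 0 z := by
  refine twoHoleGapRealAt_zero_of_addEquiv L (swapEquiv L) (fun k => ?_) h
  have h1 : (swapEquiv L).symm (ex L) = ey L := rfl
  have h2 : (swapEquiv L).symm (-ex L) = -ey L := by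
    show ((-ex L).2, (-ex L).1) = -ey L
    unfold ex ey; ext <;> simp
  have h3 : (swapEquiv L).symm (ey L) = ex L := rfl
  have h4 : (swapEquiv L).symm (-ey L) = -ex L := by
    show ((-ey L).2, (-ey L).1) = -ex L
    unfold ex ey; ext <;> simp
  rw [h1, h2, h3, h4]
  ring

/-- the mirror `(a,b) ↦ (−a,b)` as an additive automorphism of the torus. [folklore] -/
def mirrorEquiv : Tor L ≃+ Tor L := AddEquiv.prodCongr (AddEquiv.neg (ZMod L)) (AddEquiv.refl (ZMod L))

omit [NeZero L] in
/-- `mirrorEquiv (a,b) = (−a,b)`. [folklore] -/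
theorem mirrorEquiv_apply (z : Tor L) : mirrorEquiv L z = (-z.1, z.2) := rfl

omit [NeZero L] in
/-- the mirror is an involution: `mirrorEquiv⁻¹ (a,b) = (−a,b)`. [folklore] -/
theorem mirrorEquiv_symm_apply (z : Tor L) : (mirrorEquiv L).symm z = (-z.1, z.2) := by
  rw [AddEquiv.symm_apply_eq, mirrorEquiv_apply]
  simp

/-- `(a,b) ↦ (−a,b)`: the pair `(0, (−z₁, z₂))` gives `(0, z)`. [folklore] -/
theorem twoHoleGapRealAt_zero_of_mirror {g : ℝ} {z : Tor L} (h : TwoHoleGapRealAt L g 0 (-z.1, z.2)) :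
    TwoHoleGapRealAt L g 0 z := by
  refine twoHoleGapRealAt_zero_of_addEquiv L (mirrorEquiv L) (fun k => ?_) ?_
  · have h1 : (mirrorEquiv L).symm (ex L) = -ex L := by rw [mirrorEquiv_symm_apply]; unfold ex; ext <;> simp
    have h2 : (mirrorEquiv L).symm (-ex L) = ex L := by rw [mirrorEquiv_symm_apply]; unfold ex; ext <;> simp
    have h3 : (mirrorEquiv L).symm (ey L) = ey L := by rw [mirrorEquiv_symm_apply]; unfold ey; ext <;> simp
    have h4 : (mirrorEquiv L).symm (-ey L) = -ey L := by rw [mirrorEquiv_symm_apply]; unfold ey; ext <;> simp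
    rw [h1, h2, h3, h4]
    ring
  · rw [mirrorEquiv_apply]; exact h

/-! ## Representatives -/

/-- the eight images of `z = (a,b)` under the point group `D₄` of the square torus. [folklore] -/
def d4Orbit (z : Tor L) : Finset (Tor L) :=
  {z, -z, (z.2, z.1), -(z.2, z.1), (-z.1, z.2), -(-z.1, z.2), (z.2, -z.1), -(z.2, -z.1)}

/-- every element of the `D₄`-orbit transports the single-pair inequality back to `(0, z)`. [folklore] -/
theorem twoHoleGapRealAt_zero_of_mem_orbit {g : ℝ} {z s : Tor L} (hs : s ∈ d4Orbit L z)
    (h : TwoHoleGapRealAt L g 0 s) : TwoHoleGapRealAt L g 0 z := by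
  unfold d4Orbit at hs
  simp only [Finset.mem_insert, Finset.mem_singleton] at hs
  rcases hs with rfl | rfl | rfl | rfl | rfl | rfl | rfl | rfl
  · exact h
  · exact twoHoleGapRealAt_zero_of_neg L h
  · exact twoHoleGapRealAt_zero_of_swap L h
  · exact twoHoleGapRealAt_zero_of_swap L (twoHoleGapRealAt_zero_of_neg L h)
  · exact twoHoleGapRealAt_zero_of_mirror L h
  · exact twoHoleGapRealAt_zero_of_mirror L (twoHoleGapRealAt_zero_of_neg L h)
  · -- `(z.2, -z.1)`: `z ← mirror ← (-z.1, z.2) ← swap ← (z.2, -z.1)`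
    exact twoHoleGapRealAt_zero_of_mirror L (twoHoleGapRealAt_zero_of_swap L h)
  · -- `-(z.2, -z.1) = (-z.2, z.1)`: `z ← swap ← (z.2, z.1) ← mirror ← (-z.2, z.1)`
    have e : -((z.2, -z.1) : Tor L) = (-z.2, z.1) := by ext <;> simp
    rw [e] at h
    exact twoHoleGapRealAt_zero_of_swap L (twoHoleGapRealAt_zero_of_mirror L h)

/-- ★★ **representatives suffice:** if `S` meets the `D₄`-orbit of every nonzero separation (a finite check, `decide`-able at fixed `L`)
and the real single-pair inequality holds for `(0, s)`, `s ∈ S`, then `TwoHoleGap L g`. [folklore] -/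
theorem twoHoleGap_of_reps {g : ℝ} (S : Finset (Tor L))
    (hcover : ∀ z : Tor L, z ≠ 0 → ∃ s ∈ S, s ∈ d4Orbit L z)
    (hS : ∀ s ∈ S, TwoHoleGapRealAt L g 0 s) : TwoHoleGap L g := by
  refine twoHoleGap_of_real L fun z₁ z₂ hne => ?_
  apply twoHoleGapRealAt_of_translate
  have hz : z₂ - z₁ ≠ 0 := sub_ne_zero.mpr (Ne.symm hne)
  obtain ⟨s, hsS, hs⟩ := hcover (z₂ - z₁) hz
  exact twoHoleGapRealAt_zero_of_mem_orbit L hs (hS s hsS)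

/-! ## Monotonicity -/

/-- `TwoHoleGap` is monotone in the constant: `g' ≤ g` and `TwoHoleGap L g` give `TwoHoleGap L g'`. [folklore] -/
theorem twoHoleGap_mono {g g' : ℝ} (hle : g' ≤ g) (h : TwoHoleGap L g) : TwoHoleGap L g' := by
  intro z₁ z₂ hne f hmean
  have h1 := h z₁ z₂ hne f hmean
  have hnn : 0 ≤ ∑ x : Tor L, (if (x = z₁ ∨ x = z₂) then (0 : ℝ) else ‖f x‖ ^ 2) :=
    Finset.sum_nonneg fun x _ => by split_ifs <;> positivity
  nlinarith

end Summit.HubbardSuperconductivity.HubbardSuperconductivity.Theorems.AnisotropyChord.Transfer.Fibre3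

end
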